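import Summits.Ventures.CertifiedArithmetic.LowPrec.DoubleRoundingFMAWideCore

/-!
# Double rounding of the FMA through a register with `P_ψ ≥ 3 P_φ` (THEOREM D-fma-W, soundness)

HONEST FRAMING: certified error envelopes and provably optimal rounding/accumulation schemes for
low-precision formats under stated cost models; every table by two implementations; no hardware
or vendor claims.

THEOREM D-fma (`DoubleRoundingFMA.lean`, clause F) proves `DFma φ ψ` — one fused multiply-add of
`φ`-data executed in `ψ` and converted to `φ` is the correctly rounded FMA of `φ` — when window A
is EMPTY (`maxScaled φ < 2^P_ψ`), and THEOREM N-fma-A (`DoubleRoundingFMAWindowA.lean`) refutes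
it when window A contains the significand `3·(2^P_φ - 1)`.  This file closes the gap between the
two in the WIDE regime `P_ψ ≥ 3 P_φ` (window B then never matters): under the side conditions of
clause F, `fmaWideTest φ ψ → DFma φ ψ` (`dFma_of_fmaWideTest`; the test, on the record alone, is
defined in `DoubleRoundingFMAWideCore.lean`: no midpoint of `φ` available in the binades
`≥ 2^P_ψ` quanta has a FACTORABLE significand `2^P_φ + 2j + 1 = a₁·b₁`, `a₁, b₁ < 2^P_φ`).

ANATOMY (`dFma_wide_pos`, in units `ν = quantum ψ / 2` as in `dFma_pos`): a slip puts `fl_ψ x`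
on a midpoint `M = (2J+1)·2^g` of `φ` with `0 < |P + C - M| ≤ 2^t` and `2^(m_ψ+t+1) ≤ M`; the
integer core `fma_slip_core_wide` shows that for `g ≥ t + 2 P_φ` (automatic when `P_ψ ≥ 3 P_φ`)
the only possibility is `P = M` EXACTLY: the product `a·b` IS the midpoint and the addend `c` is
the whole rounding error, `0 < |c| ≤ ½ ulp_ψ(M)`.  As `|c| ≥ quantum φ`, the binade of `M` is
`≥ 2^P_ψ` quanta, the lower neighbour `v` of the midpoint is a normal datum of exponent code
`e ≥ P_ψ - m_φ + 1`, and comparing odd parts in `P = M` gives `2^P_φ + 2·man v + 1 = a₁·b₁` with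
`a₁`, `b₁` the odd parts of the significands of `a`, `b` — a factorable significand of an
available midpoint (`man v < topMan φ` in the top binade because `v + ulp ≤ maxRat φ`), which
the test excludes.

The converse (every factorable available midpoint IS hit: `a = a₁·2^(P_ψ-P_φ)`, `b = b₁`,
`c = ±quantum φ`), the criterion as an `iff`, its prime-number reading (in the boundary binade
`DFma` needs `2^P_φ + 1, 2^P_φ + 3, …` prime — `2^P_φ + 1` is then a FERMAT prime) and the named
cells are `DoubleRoundingFMAWideIff.lean`; implementation A = `code/enum/fma_wide_law.py`
(certificate `certs/enum/DOUBLE-ROUNDING-FMA-WIDE.json`: the structured decision agrees with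
this test on all 554 on-hypothesis record pairs of its census and with brute force on the small
records).

References: [MartinDorelMelquiondMuller2013] Property 2.1 (a slip forces a midpoint);
[BoldoMelquiond2008] Thm 3 and [Roux2014] §2 (the `2p + 2` criteria this refines for the FMA of
records with few exponents); [Figueroa1995] §3; [HighamPranesh2019] p. C589 (simulation of low
precisions through one binary64 FMA). We found no statement of the factorable-midpoint criterion
in the literature searched (queries in the cell's notes). No hardware or vendor claims.
-/


namespace Summit.Ventures.CertifiedArithmetic

open Literature.ComputerArithmetic.FloatingPoint
open Literature.ComputerArithmetic.FloatingPoint.Format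
open Literature.ComputerArithmetic.FloatingPoint.MiniFloat

/-! ## §1 Soundness of the test -/

/-- THEOREM D-fma-W, positive inputs with a nonzero product: with `P_ψ ≥ 3 P_φ` and the side
conditions of clause F, a slip of `fl_φ ∘ fl_ψ` at `x = a·b + c > 0` forces `a·b` to be a
midpoint of `φ` of a binade `≥ 2^(m_ψ+1)` quanta whose significand is `a₁·b₁` (odd parts of
`a`, `b`) — excluded by `fmaWideTest`. [this packet] -/
theorem dFma_wide_pos {φ ψ : Format} (hE : embedsTest φ ψ = true)
    (hm3 : 3 * (φ.manBits + 1) ≤ ψ.manBits + 1) (hb : φ.bias ≤ ψ.bias)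
    (hq2 : ψ.qexp ≤ 2 * φ.qexp) (hnorm : ψ.qexp + ψ.manBits + 1 ≤ φ.qexp)
    (hW : fmaWideTest φ ψ = true) {a b c : MiniFloat φ} (ha : a.scaledMag ≠ 0)
    (hb0 : b.scaledMag ≠ 0) (hx : 0 < a.toRat * b.toRat + c.toRat) :
    (roundNE φ (roundNE ψ (a.toRat * b.toRat + c.toRat)).toRat).toRat
      = (roundNE φ (a.toRat * b.toRat + c.toRat)).toRat := by
  by_contra h
  set x := a.toRat * b.toRat + c.toRat with hxdef
  have hQφ := φ.quantum_pos; have hQ := ψ.quantum_pos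
  have hq : ψ.qexp ≤ φ.qexp := by omega
  obtain ⟨zM, hzM⟩ := exists_toRat_eq_maxRat_of_test hE
  have hmax : φ.maxRat ≤ ψ.maxRat := hzM ▸ (le_abs_self _).trans (abs_toRat_le_maxRat zM)
  -- the slip anatomy in `φ`: `fl_ψ x = m = (v+u)/2`, `u = v + G` (as in `dFma_pos`)
  obtain ⟨v, u, hv0, hvx, hxu, hgap, hmid, hxm⟩ := slip_midpoint_of_pos (by omega) hb hmax hx h
  set y := roundNE ψ x with hydef
  obtain ⟨u', hu'⟩ := exists_toRat_eq_add_ulp hv0 (hvx.trans hxu)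
  have hule := add_ulp_le_of_lt hv0 (hvx.trans hxu)
  have hGpos : (0:ℚ) < 2 ^ (v.expCode - 1) * φ.quantum := by positivity
  have hueq : u.toRat = v.toRat + 2 ^ (v.expCode - 1) * φ.quantum := by
    rcases hgap u' with h1 | h1 <;> linarith
  have hutop : u.toRat ≤ 2 ^ (φ.manBits + 1 + (v.expCode - 1)) * φ.quantum :=
    hueq ▸ toRat_add_ulp_le hv0
  have humax : u.toRat ≤ φ.maxRat := (le_abs_self _).trans (abs_toRat_le_maxRat u)
  have hyu : y.toRat < u.toRat := by rw [hmid]; linarith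
  have hy0 : 0 ≤ y.toRat := by rw [hmid]; linarith
  -- quanta: `quantum φ = 2^D quantum ψ`, `quantum φ² = 2^S quantum ψ`, `ν = quantum ψ / 2`
  set D := (φ.qexp - ψ.qexp).toNat with hDdef
  have hDq : φ.quantum = 2 ^ D * ψ.quantum := quantum_eq_two_pow_mul hq
  have hD1 : ψ.manBits + 1 ≤ D := by omega
  set S := (2 * φ.qexp - ψ.qexp).toNat with hSdef
  have hS0 : ((S : ℕ) : ℤ) = 2 * φ.qexp - ψ.qexp := by
    rw [hSdef]; exact Int.toNat_of_nonneg (by omega)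
  have hSq : φ.quantum * φ.quantum = 2 ^ S * ψ.quantum := by
    unfold Format.quantum
    rw [← zpow_natCast, ← zpow_add₀ two_ne_zero, ← zpow_add₀ two_ne_zero, hS0]
    congr 1; ring
  set ν : ℚ := ψ.quantum / 2 with hνdef
  have hν : 0 < ν := by positivity
  have hQν : ψ.quantum = 2 * ν := by rw [hνdef]; ring
  -- the integers
  have hyQ : y.toRat = (y.scaledMag : ℚ) * ψ.quantum := by
    rw [toRat_eq_toInt_mul, toInt_eq_scaledMag_of_nonneg hy0]; push_cast; rfl
  have hvQ : v.toRat = (v.scaledMag : ℚ) * φ.quantum := by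
    rw [toRat_eq_toInt_mul, toInt_eq_scaledMag_of_nonneg hv0]; push_cast; rfl
  obtain ⟨V', hV'⟩ := pow_ulpExp_dvd_scaledMag v
  set g := (v.expCode - 1) + D with hgdef
  set M : ℤ := 2 * (y.scaledMag : ℤ) with hMdef
  have hmν : y.toRat = (M : ℚ) * ν := by rw [hyQ, hMdef, hQν]; push_cast; ring
  have hGν : 2 ^ (v.expCode - 1) * φ.quantum = 2 * (2:ℚ) ^ g * ν := by
    rw [hDq, hQν, hgdef, pow_add]; ring
  have hMg : M = (2 * (V' : ℤ) + 1) * 2 ^ g := by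
    have h1 : (M : ℚ) * ν = ((2 * (V' : ℤ) + 1) * 2 ^ g : ℤ) * ν := by
      rw [← hmν, hmid, hueq, hvQ, hV', hGν, hDq, hQν, hgdef]
      push_cast; ring
    exact_mod_cast mul_right_cancel₀ (ne_of_gt hν) h1
  -- the result is normal in `ψ`: `expCode ≥ 1`
  have hE1 : 1 ≤ y.expCode := by
    by_contra h0
    have h0 : y.expCode = 0 := by omega
    have hlt : y.scaledMag < 2 ^ ψ.manBits := by
      have := y.man_lt; unfold scaledMag; rw [h0, Format.scaled_zero]; exact this
    have h1 : φ.quantum ≤ 2 ^ (v.expCode - 1) * φ.quantum :=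
      le_mul_of_one_le_left hQφ.le (one_le_pow₀ (by norm_num))
    have h2 : (2:ℚ) ^ D * ψ.quantum ≤ (2 * y.scaledMag : ℚ) * ψ.quantum := by
      rw [← hDq, mul_assoc, ← hyQ, hmid, hueq]; linarith
    have h3 : (2 ^ D : ℕ) ≤ 2 * y.scaledMag := by exact_mod_cast le_of_mul_le_mul_right h2 hQ
    have h4 : 2 ^ (ψ.manBits + 1) ≤ 2 ^ D := Nat.pow_le_pow_right (by norm_num) hD1
    rw [pow_succ] at h4; omega
  set t := y.expCode - 1 with htdef
  have hSy_lo : 2 ^ (ψ.manBits + t) ≤ y.scaledMag := pow_le_scaledMag_of_expCode_pos y hE1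
  -- (a) correct rounding in `ψ`: `|x - m| ≤ 2^t ν`
  have hyz : y.toRat < zM.toRat := by rw [hzM]; linarith
  have habs : |x - y.toRat| ≤ 2 ^ t * ν := by
    have := abs_sub_roundNE_le_half_ulp hy0 hyz hE1
    rw [← hydef, hQν] at this; convert this using 1; rw [htdef]; ring
  -- `x = (P + C) ν`, `c = C ν`
  set P : ℤ := a.toInt * b.toInt * 2 ^ (S + 1) with hPdef
  set C : ℤ := c.toInt * 2 ^ (D + 1) with hCdef
  have hxν : x = ((P + C : ℤ) : ℚ) * ν := by
    calc x = (a.toInt * b.toInt : ℚ) * (φ.quantum * φ.quantum) + c.toInt * φ.quantum := by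
          rw [hxdef, toRat_eq_toInt_mul, toRat_eq_toInt_mul, toRat_eq_toInt_mul]; ring
      _ = (a.toInt * b.toInt : ℚ) * (2 ^ S * (2 * ν)) + c.toInt * (2 ^ D * (2 * ν)) := by
          rw [hSq, hDq, hQν]
      _ = ((P + C : ℤ) : ℚ) * ν := by rw [hPdef, hCdef]; push_cast; ring
  have hcν : c.toRat = (C : ℚ) * ν := by
    rw [toRat_eq_toInt_mul, hCdef, hDq, hQν]; push_cast; ring
  -- `N = P + C - M ≠ 0`, `|N| ≤ 2^t`
  have hN0 : P + C - M ≠ 0 := by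
    intro h0; apply hxm; rw [hxν, hmν]; congr 1; exact_mod_cast (sub_eq_zero.mp h0)
  have hNle : |P + C - M| ≤ (2:ℤ) ^ t := by
    have h1 : (|((P + C - M : ℤ) : ℚ)|) * ν ≤ (2:ℚ) ^ t * ν := by
      rw [← abs_of_pos hν, ← abs_mul, abs_of_pos hν]
      have e : ((P + C - M : ℤ) : ℚ) * ν = x - y.toRat := by rw [hxν, hmν]; push_cast; ring
      rw [e]; exact habs
    exact_mod_cast le_of_mul_le_mul_right h1 hν
  -- `v = (M - 2^g) ν`, `u = (M + 2^g) ν`, hence `|C - M| ≥ 2^g`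
  have hvν : v.toRat = ((M : ℚ) - 2 ^ g) * ν := by
    have e : v.toRat = y.toRat - 2 ^ (v.expCode - 1) * φ.quantum / 2 := by rw [hmid, hueq]; ring
    rw [e, hmν, hGν]; ring
  have huν : u.toRat = ((M : ℚ) + 2 ^ g) * ν := by rw [hueq, hvν, hGν]; ring
  have hfar : (2:ℤ) ^ g ≤ |C - M| := by
    rcases hgap c with h1 | h1
    · rw [hcν, hvν] at h1
      have h3 : (C : ℤ) ≤ M - 2 ^ g := by exact_mod_cast le_of_mul_le_mul_right h1 hν
      rw [abs_sub_comm]; exact le_trans (by linarith) (le_abs_self _)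
    · rw [hcν, huν] at h1
      have h3 : M + 2 ^ g ≤ (C : ℤ) := by exact_mod_cast le_of_mul_le_mul_right h1 hν
      exact le_trans (by linarith) (le_abs_self _)
  -- binade bookkeeping: `2^(m_ψ + t + 1) ≤ M < 2^(m_φ + 1 + g + 1)`
  have hMlt : M < (2:ℤ) ^ (φ.manBits + 1 + g + 1) := by
    have h1 : (M : ℚ) * ν < (2:ℚ) ^ (φ.manBits + 1 + g + 1) * ν := by
      rw [← hmν]
      calc y.toRat < u.toRat := hyu
        _ ≤ 2 ^ (φ.manBits + 1 + (v.expCode - 1)) * φ.quantum := hutop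
        _ = (2:ℚ) ^ (φ.manBits + 1 + g + 1) * ν := by
            rw [hDq, hQν, hgdef]; simp only [pow_add, pow_one]; ring
    exact_mod_cast lt_of_mul_lt_mul_right h1 hν.le
  have hMge : (2:ℤ) ^ (ψ.manBits + t + 1) ≤ M := by
    have h1 : ((2 ^ (ψ.manBits + t) : ℕ) : ℤ) ≤ y.scaledMag := by exact_mod_cast hSy_lo
    push_cast at h1
    rw [hMdef, pow_succ]; linarith
  have hexp : ψ.manBits + t < φ.manBits + 1 + g := by
    have := (pow_lt_pow_iff_right₀ (by norm_num : (1:ℤ) < 2)).mp (hMge.trans_lt hMlt); omega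
  -- the product: `2^k ∣ P` (`k` exact), `|P| ≤ (2^P_φ - 1)² 2^k`
  obtain ⟨αa, a₁, ha₁, haα, ha₁lt⟩ := exists_odd_part a ha
  obtain ⟨αb, b₁, hb₁, hbα, hb₁lt⟩ := exists_odd_part b hb0
  set k := αa + αb + (S + 1) with hkdef
  have h2w : ∀ i : ℕ, ((2:ℤ) ^ i).natAbs = 2 ^ i := fun i => by rw [Int.natAbs_pow]; rfl
  have hPabs : P.natAbs = 2 ^ k * (a₁ * b₁) := by
    rw [hPdef, Int.natAbs_mul, Int.natAbs_mul, natAbs_toInt, natAbs_toInt, h2w, haα, hbα, hkdef]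
    simp only [pow_add]; ring
  have hkP : (2:ℤ) ^ k ∣ P := by
    rw [← Int.natAbs_dvd_natAbs, h2w, hPabs]; exact Dvd.intro _ rfl
  have hPle : |P| ≤ ((2:ℤ) ^ (φ.manBits + 1) - 1) ^ 2 * 2 ^ k := by
    rw [Int.abs_eq_natAbs, hPabs]; push_cast
    have h1 : (a₁ : ℤ) + 1 ≤ 2 ^ (φ.manBits + 1) := by exact_mod_cast ha₁lt
    have h2 : (b₁ : ℤ) + 1 ≤ 2 ^ (φ.manBits + 1) := by exact_mod_cast hb₁lt
    have h12 : (a₁ : ℤ) * b₁ ≤ (2 ^ (φ.manBits + 1) - 1) ^ 2 := by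
      rw [sq]; exact mul_le_mul (by linarith) (by linarith) (by positivity) (by linarith)
    rw [mul_comm]; exact mul_le_mul_of_nonneg_right h12 (by positivity)
  have hCγ : (2:ℤ) ^ (D + 1) ∣ C := by rw [hCdef]; exact dvd_mul_left _ _
  -- the addend: coarse (`2^(t+1) ∣ C`) or small (`|C| ≤ (2^P_φ - 1) 2^t`)
  have hC : (2:ℤ) ^ (t + 1) ∣ C ∨ |C| ≤ ((2:ℤ) ^ (φ.manBits + 1) - 1) * 2 ^ t := by
    by_cases hc0 : c.scaledMag = 0
    · left; rw [hCdef]; simp [MiniFloat.toInt, hc0]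
    · obtain ⟨αc, c₁, hc₁, hcα, hc₁lt⟩ := exists_odd_part c hc0
      have hCabs : C.natAbs = 2 ^ (αc + (D + 1)) * c₁ := by
        rw [hCdef, Int.natAbs_mul, natAbs_toInt, h2w, hcα, pow_add]; ring
      by_cases hw : t + 1 ≤ αc + (D + 1)
      · left
        rw [← Int.natAbs_dvd_natAbs, h2w, hCabs]
        exact Dvd.dvd.mul_right (pow_dvd_pow 2 hw) _
      · right
        rw [Int.abs_eq_natAbs, hCabs]; push_cast
        have h1 : (c₁ : ℤ) + 1 ≤ 2 ^ (φ.manBits + 1) := by exact_mod_cast hc₁lt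
        have h2 : (2:ℤ) ^ (αc + (D + 1)) ≤ 2 ^ t := pow_le_pow_right₀ (by norm_num) (by omega)
        calc (2:ℤ) ^ (αc + (D + 1)) * c₁ ≤ 2 ^ t * c₁ :=
              mul_le_mul_of_nonneg_right h2 (by positivity)
          _ ≤ 2 ^ t * (2 ^ (φ.manBits + 1) - 1) :=
              mul_le_mul_of_nonneg_left (by linarith) (by positivity)
          _ = (2 ^ (φ.manBits + 1) - 1) * 2 ^ t := mul_comm _ _
  -- THE CORE: the product is the midpoint
  have hPM : P = M :=
    fma_slip_core_wide (p := φ.manBits + 1) (by omega) hkP hPle hC hMg (by omega)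
      (le_trans (pow_le_pow_right₀ (by norm_num) (by omega)) hMge) hN0 hNle hfar
  -- so `c` is the whole rounding error: `0 < |C| ≤ 2^t`, `2^(D+1) ∣ C` ⇒ `t ≥ D + 1`
  have hNC : P + C - M = C := by rw [hPM]; ring
  rw [hNC] at hN0 hNle
  have htD : D + 1 ≤ t := (pow_le_pow_iff_right₀ (by norm_num : (1:ℤ) < 2)).mp
    ((Int.le_of_dvd (abs_pos.mpr hN0) ((dvd_abs _ _).mpr hCγ)).trans hNle)
  -- odd parts: `k = g`, `a₁ b₁ = 2V' + 1`
  have hPabsM : 2 ^ k * (a₁ * b₁) = 2 ^ g * (2 * V' + 1) := by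
    have h1 : P.natAbs = M.natAbs := by rw [hPM]
    have h2 : M.natAbs = (2 * V' + 1) * 2 ^ g := by
      rw [hMg, show (2 * (V' : ℤ) + 1) * 2 ^ g = (((2 * V' + 1) * 2 ^ g : ℕ) : ℤ) by push_cast; ring,
        Int.natAbs_natCast]
    rw [hPabs, h2] at h1; rw [h1]; ring
  -- (uniqueness of the odd part, folklore; cf. `Literature.NumberTheory.Automorphic.
  -- two_pow_mul_odd_inj`, not imported here to keep this file's closure inside the cell)
  have hinj : ∀ {k g A B : ℕ}, Odd A → Odd B → 2 ^ k * A = 2 ^ g * B → A = B := by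
    intro k g A B hA hB h
    have key : ∀ {k g A B : ℕ}, Odd A → k < g → 2 ^ k * A ≠ 2 ^ g * B := by
      intro k g A B hA hlt h
      obtain ⟨d, rfl⟩ := Nat.exists_eq_add_of_lt hlt
      have h' : A = 2 ^ (d + 1) * B := by
        apply Nat.eq_of_mul_eq_mul_left (Nat.two_pow_pos k)
        rw [h, show k + d + 1 = k + (d + 1) by ring, pow_add, mul_assoc]
      exact hA.not_two_dvd_nat ⟨2 ^ d * B, by rw [h', pow_succ]; ring⟩
    rcases lt_trichotomy k g with hlt | rfl | hgt
    · exact absurd h (key hA hlt)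
    · exact Nat.eq_of_mul_eq_mul_left (Nat.two_pow_pos k) h
    · exact absurd h.symm (key hB hgt)
  have hO := hinj (Nat.odd_mul.mpr ⟨ha₁, hb₁⟩) (odd_two_mul_add_one V') hPabsM
  -- the binade of the midpoint: `2V'+1 < 2^(m+2)` and `M ≥ 2^(m_ψ+t+1)`, `t ≥ D+1`
  have hV'lt : V' < 2 ^ (φ.manBits + 1) := by
    have h1 := scaledMag_lt_pow_ulpExp v
    rw [hV', pow_add, mul_comm (2 ^ (φ.manBits + 1))] at h1
    exact Nat.lt_of_mul_lt_mul_left h1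
  have hwin : ψ.manBits + 1 ≤ φ.manBits + (v.expCode - 1) := by
    have h1 : M < (2:ℤ) ^ (φ.manBits + 2) * 2 ^ g := by
      rw [hMg]
      have h' : ((V' : ℕ) : ℤ) < 2 ^ (φ.manBits + 1) := by exact_mod_cast hV'lt
      have h3 : (2 * (V' : ℤ) + 1) < 2 ^ (φ.manBits + 2) := by
        rw [show φ.manBits + 2 = (φ.manBits + 1) + 1 by ring, pow_succ]; linarith
      exact mul_lt_mul_of_pos_right h3 (pow_pos (by norm_num) g)
    rw [← pow_add] at h1
    have h2 := (pow_lt_pow_iff_right₀ (by norm_num : (1:ℤ) < 2)).mp (hMge.trans_lt h1)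
    omega
  -- `v` is normal: `V' = 2^m + man v`
  have hVman : V' = 2 ^ φ.manBits + v.man := by
    have h1 : v.scaledMag = (2 ^ φ.manBits + v.man) * 2 ^ (v.expCode - 1) := by
      unfold scaledMag Format.scaled; rw [if_neg (by omega)]
    rw [hV', mul_comm] at h1
    exact Nat.eq_of_mul_eq_mul_right (by positivity) h1
  -- availability: `j = man v < fmaWideCount φ ψ`
  have hcount : v.man < fmaWideCount φ ψ := by
    have hele := v.expCode_le
    have hman := v.man_lt
    unfold fmaWideCount
    rw [if_neg (by omega)]
    by_cases hc2 : φ.manBits + φ.emaxCode = ψ.manBits + 2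
    · rw [if_pos hc2]
      have hee : v.expCode = φ.emaxCode := by omega
      have h1 : u.toRat ≤ φ.maxRat := humax
      rw [hueq, hvQ, hV', hVman, hee] at h1
      unfold Format.maxRat Format.maxScaled Format.scaled at h1
      rw [if_neg (by omega : ¬ φ.emaxCode = 0)] at h1
      have h2 : ((2 ^ (φ.emaxCode - 1) * (2 ^ φ.manBits + v.man) : ℕ) : ℚ) * φ.quantum
            + 2 ^ (φ.emaxCode - 1) * φ.quantum
          = (((2 ^ φ.manBits + v.man + 1) * 2 ^ (φ.emaxCode - 1) : ℕ) : ℚ) * φ.quantum := by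
        push_cast; ring
      rw [h2] at h1
      have h3 : (2 ^ φ.manBits + v.man + 1) * 2 ^ (φ.emaxCode - 1)
          ≤ (2 ^ φ.manBits + φ.topMan) * 2 ^ (φ.emaxCode - 1) := by
        exact_mod_cast le_of_mul_le_mul_right h1 hQφ
      have h4 := Nat.le_of_mul_le_mul_right h3 (by positivity)
      omega
    · rw [if_neg hc2]; exact hman
  -- the test excludes the factorable significand `2^P + 2 man + 1 = 2V' + 1 = a₁ b₁`
  have hall : ∀ j ∈ List.range (fmaWideCount φ ψ),
      (! sigPairTest (φ.manBits + 1) (2 ^ (φ.manBits + 1) + 2 * j + 1)) = true := by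
    have h1 := hW; unfold fmaWideTest at h1; exact List.all_eq_true.mp h1
  have hj := hall v.man (List.mem_range.mpr hcount)
  have hO' : 2 ^ (φ.manBits + 1) + 2 * v.man + 1 = a₁ * b₁ := by rw [hO, hVman, pow_succ]; ring
  have ha1 : 1 < a₁ := by
    by_contra h1
    have : a₁ = 1 := by obtain ⟨i, hi⟩ := ha₁; omega
    rw [this, one_mul] at hO'; omega
  have hb1 : 1 < b₁ := by
    by_contra h1
    have : b₁ = 1 := by obtain ⟨i, hi⟩ := hb₁; omega
    rw [this, mul_one] at hO'; omega
  have hOlt : a₁ * b₁ < 2 ^ (φ.manBits + 1 + 1) := by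
    rw [← hO', pow_succ]; have := v.man_lt; omega
  rw [hO', sigPairTest_mul_eq_true ha1 hb1 hOlt] at hj
  exact Bool.noConfusion hj

/-- THEOREM D-fma-W (soundness), every pair of format records: `F_φ ⊆ F_ψ`, `P_ψ ≥ 3 P_φ`,
`bias_φ ≤ bias_ψ`, `L_ψ ≤ 2 L_φ`, `L_ψ + P_ψ ≤ L_φ` and `fmaWideTest φ ψ` (no available midpoint
of `φ` in the binades `≥ 2^P_ψ` quanta has a factorable significand) imply `DFma φ ψ`.
Implementation A = `code/enum/fma_wide_law.py`. [this packet] -/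
theorem dFma_of_fmaWideTest {φ ψ : Format} (hE : embedsTest φ ψ = true)
    (hm3 : 3 * (φ.manBits + 1) ≤ ψ.manBits + 1) (hb : φ.bias ≤ ψ.bias)
    (hq2 : ψ.qexp ≤ 2 * φ.qexp) (hnorm : ψ.qexp + ψ.manBits + 1 ≤ φ.qexp)
    (hW : fmaWideTest φ ψ = true) : DFma φ ψ := by
  intro a b c
  by_cases hab : a.scaledMag = 0 ∨ b.scaledMag = 0
  · have h0 : a.toRat * b.toRat = 0 := by
      rcases hab with h0 | h0 <;>
        simp [toRat_eq_toInt_mul a, toRat_eq_toInt_mul b, MiniFloat.toInt, h0]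
    rw [h0, zero_add]
    exact toRat_roundNE_roundNE_of_exists (embeds_of_test hE c)
  simp only [not_or] at hab
  rcases lt_trichotomy (a.toRat * b.toRat + c.toRat) 0 with hneg | h0 | hpos
  · have h := dFma_wide_pos hE hm3 hb hq2 hnorm hW (a := a.flipSign) (b := b) (c := c.flipSign)
      hab.1 hab.2 (by simp only [toRat_flipSign]; linarith)
    simp only [toRat_flipSign] at h
    have e : -a.toRat * b.toRat + -c.toRat = -(a.toRat * b.toRat + c.toRat) := by ring
    rwa [e, toRat_roundNE_neg, toRat_roundNE_neg, toRat_roundNE_neg, neg_inj] at h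
  · simp only [h0, toRat_roundNE_zero]
  · exact dFma_wide_pos hE hm3 hb hq2 hnorm hW hab.1 hab.2 hpos

/-- The packaged test is sound for EVERY pair of records. [this packet] -/
theorem dFma_of_wideTest {φ ψ : Format} (h : dFmaWideTest φ ψ = true) : DFma φ ψ := by
  simp only [dFmaWideTest, Bool.and_eq_true, decide_eq_true_eq] at h
  obtain ⟨⟨⟨⟨⟨hE, hm⟩, hb⟩, hq⟩, hn⟩, hW⟩ := h
  exact dFma_of_fmaWideTest hE hm hb hq hn hW

end Summit.Ventures.CertifiedArithmetic
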